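import Summits.QuantumFields.BalabanUV.T4Continuum.Support.SubstrateAvgTowerPlumbing
import Summits.QuantumFields.BalabanUV.T4Continuum.Support.BalabanAveragedTowerApply

/-!
# SUBSTRATE — W-25b (PRE-ASSEMBLY) = L-E19: THE FACTORISATION CLAUSES OF THE AVERAGING TOWER AT THE DATUM, IN NE2's TOWER CURRENCY —
# start sites `stOf` (the charted block centres), one-step corrections `CfOf := ι ∘ corr`, the AVERAGING clause `R k = CfOf k · Π_{t<L} R (k+1)(st + t e_μ)`,
# the STRAIGHT clause for the axial tower, the start-site shift law, the correction letter from the displayed `κ`, and the finest-level clauses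
# (`R = S`, size `α′`, Lipschitz `β′` at `k ≥ K`) — every field of the NE5 owner's `FactorisationData` (g39-d `B13ReadingsAvgTowerUniform`, STAGED
# l.23219), stated WITHOUT importing it, so that W-25b proper is a one-screen assembly ON EVENT «g39-a…d LANDED» (typer (ο10)∕(π2); t4-dagwriter Q49)

Cell `pub-balaban`, SUBSTRATE cell, seat `b2b-balaban-substrate-p3` (gen 4).  Summits-side under the LEAN PLACEMENT RULE ([dict] chart bookkeeping +
[folklore] algebra at the datum; nothing printed is asserted; no citation tags; no `Prop`-valued fact minted).  Follower of W-25a PART 1∕2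
(`SubstrateAvgTowerStructure`: `avgTower`, `axialTower`, `avgTower_succ`, `pathProd_eq_pprod`; `SubstrateAvgTowerPlumbing`: `towerOfS`, §5 top-level caveat),
p217365 `SubstrateBackgroundTransporters` (`towerOf`, `siteIdx`, `siteIdx_shift`, `size_towerOf_of_le`, `lipschitz_towerOf_of_le`), V1 `Setup.emb`, `AveragingRT.lineSite`∕`line`,
NE2's `cpt`∕`off`∕`tstep`∕`tau` and `BalabanAveragedTowerApply.cpt_add` BY NAME.

WHAT.
* §1 CHART GEOMETRY ([dict]): `siteIdx_lineSite` (`e (lineSite c t) = e (emb c₋) + tstep dir t`), `siteIdx_emb` (V1's block CENTRE `emb y = yL + (L−1)∕2` is NE2's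
  CORNER `cpt` plus the constant offset `off (fun _ => (L−1)∕2)`), the START SITES **`stOf P k μ i := cpt i.1 + off (const (L−1)∕2)`**, `stOf_eq_siteIdx_emb`, and the
  shift law **`stOf_tau`** (`stOf k μ (τ_ν i) = stOf k μ i + tstep ν L`; `cpt_add` + `cpt_unitVec`).
* §2 LEVEL REINDEXING: **`towerOf_eq_of_level`** (`towerOf P ι U k = transV (siteIdx P hn) ι (U n)` for ANY `n` with `n + k = K` — dissolves the `K − k` casts),
  `towerOf_chart'`.
* §3 THE CLAUSES for `R := towerOf P ι (avgTower ℰ V)`, `S := towerOf P ι (axialTower V)`: **`straight_clause`** (`k < K`: `S k μ i = Π_{t<L} S (k+1) μ (stOf k μ i + tstep μ t, i.2)`,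
  ordered `List` product), **`CfOf`** (`:= ι (corr ℰ (avgTower ℰ V (K−(k+1))) ⟨e⁻¹ i.1, μ⟩)` for `k < K`, `1` beyond) and **`averaging_clause`**
  (`R k μ i = CfOf k μ i * Π_{t<L} R (k+1) μ (stOf k μ i + tstep μ t, i.2)`), **`corr_clause`** (`‖CfOf k μ i − 1‖ ≤ κ∕(lev L k)²` from `hdist : ‖ι g − 1‖ = dist1 g` and
  PART 1's displayed `hκ`), **`fin_eq_clause`** (`K ≤ k ⟹ R k = S k`), **`fin_size_clause`** ∕ **`fin_lip_clause`** (`K ≤ k`: size `α′`, Lipschitz `β′∕lev L k` from the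
  finest letters `hα′ : ∀ b, L^K·dist1 (V b) ≤ α′`, `hβ′ : ∀ x ν μ, L^K·‖ι (V (x+e_μ, ν)) − ι (V (x, ν))‖ ≤ β′∕L^K`; junk levels trivially).
NOT HERE: g39's `lprod` (= the same ordered product; the one-line bridge `lprod f n = ((List.range n).map f).prod` lands in W-25b with his module imported),
the induction (his files 3–4), (ℓ3) (windowed — §5 of PART 2 and GAPS § G-subp3g4-1), (ℓ2)(ℓ4) (displayed).

HONEST FRAMING: rung (B)+1 of the FINITE-VOLUME T⁴ programme — NOT infinite volume, NOT a mass gap, NOT Clay; spine PROVED 0∕9; NE5 ∕ NE2 NOT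
PRINTED ∕ NOT PROVED; substrate = data + structural lemmas + bookkeeping, NO estimate of any NE row (κ displayed, discharge = NE5 lineage per
Q49 (a′)); nothing of [Balaban1985Averaging] ∕ [Balaban1987RG1] is discharged.  HONEST DEPENDENCY (cell line, verbatim): continuum YM on T⁴ ⇐
BetaPertH ∧ nine spine estimates (0/9 proved); BetaPertH ⇐ (D1) ∧ (D4) ∧ CAP+tail; G-an2-4 gates asym, D1 and NE2/3/4.  0 sorry; axioms ⊆
{propext, Classical.choice, Quot.sound}.
-/

noncomputable section

open scoped BigOperators Matrix Matrix.Norms.L2Operator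

namespace Summit.QuantumFields.BalabanUV.T4Continuum.SubstrateAvgTowerFactorisation

open Literature.MathematicalPhysics.QuantumFieldTheory.Balaban1983to89
open Literature.MathematicalPhysics.QuantumFieldTheory.Balaban1983to89.B5Prop11Plancherel (Tor fine unitVec)
open Literature.MathematicalPhysics.QuantumFieldTheory.Balaban1983to89.B5Block118 (tstep tstep_zero tstep_succ)
open Literature.MathematicalPhysics.QuantumFieldTheory.Balaban1983to89.B5G183RateTorus (cpt)
open Literature.MathematicalPhysics.QuantumFieldTheory.Balaban1983to89.B5G183RateTorusW (off)
open Literature.MathematicalPhysics.QuantumFieldTheory.Balaban1983to89.B5G183RateUnitTower (lev lev_neZero)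
open Literature.MathematicalPhysics.QuantumFieldTheory.Balaban1983to89.BlockAveraging (corr avgFun blockAvg)
open Literature.MathematicalPhysics.QuantumFieldTheory.Balaban1983to89.AveragingRT (line lineSite lineSite_zero lineSite_succ pathProd axial)
open Summit.QuantumFields.BalabanUV.T4Continuum
open Summit.QuantumFields.BalabanUV.T4Continuum.BalabanAveragedTowerUnit (idx lev_succ' cast_lev' one_le_lev')
open Summit.QuantumFields.BalabanUV.T4Continuum.BalabanAveragedTowerApply (cpt_add)
open Summit.QuantumFields.BalabanUV.T4Continuum.BlockPairingGeometry (tau)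
open Summit.QuantumFields.BalabanUV.T4Continuum.SubstrateBackgroundTransporters (unitMod siteIdx siteIdx_apply siteIdx_shift transV transV_chart towerOf
  towerOf_of_le towerOf_of_lt norm_lev)
open Summit.QuantumFields.BalabanUV.T4Continuum.SubstrateAvgTowerStructure

variable (P : Params)

/-! ## §1 Chart geometry: line sites, block centres, start sites -/

section Geometry

/-- [folklore] the line sites in the tower chart: `e (lineSite c t) = e (emb c₋) + tstep dir t`. -/
theorem siteIdx_lineSite {j k : ℕ} (h : j + k = P.K) (c : PBond P (j + 1)) (t : ℕ) :
    siteIdx P h (lineSite c t) = siteIdx P h (emb c.src) + tstep (fine (lev P.L k) (unitMod P)) c.dir t := by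
  induction t with
  | zero => rw [lineSite_zero, tstep_zero, add_zero]
  | succ t ih => rw [lineSite_succ, siteIdx_shift, ih, tstep_succ, add_assoc]

/-- [folklore] `(L − 1)∕2 < L`. -/
theorem half_lt_L : (P.L - 1) / 2 < P.L := by have := P.hL.2; omega

/-- [folklore] **V1's CENTRE vs NE2's CORNER**: the chart of the block centre `emb y` is the corner `cpt` of the charted coarse site plus the constant
offset `(L−1)∕2` in every direction (`emb y = yL + (L−1)∕2`, `Setup` l.178; `.val`-preserving `ZMod.ringEquivCongr`). -/
theorem siteIdx_emb {j k : ℕ} (h : j + (k + 1) = P.K) (y : Site P (j + 1)) :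
    siteIdx P h (emb y) = cpt (lev P.L k) P.L (unitMod P) (siteIdx P (j := j + 1) (k := k) (by omega) y)
      + off (lev P.L k) P.L (unitMod P) (fun _ => ⟨(P.L - 1) / 2, half_lt_L P⟩) := by
  funext ν
  rw [Pi.add_apply, siteIdx_apply]
  simp only [emb, cpt, off, siteIdx_apply, ZMod.ringEquivCongr_val, Nat.cast_add, Nat.cast_mul, map_add, map_mul, map_natCast]
  rw [mul_comm]
  exact rfl

/-- [folklore] **THE START SITES** of the factorisation: the charted block centre above the coarse index `i`, `stOf P k μ i := cpt i.1 + off (const (L−1)∕2)`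
(the component `μ` is carried for the `FactorisationData` signature and unused). -/
def stOf (k : ℕ) (_μ : Fin P.d) (i : idx P.L (unitMod P) k) : Tor (fine (P.L * lev P.L k) (unitMod P)) :=
  cpt (lev P.L k) P.L (unitMod P) i.1 + off (lev P.L k) P.L (unitMod P) (fun _ => ⟨(P.L - 1) / 2, half_lt_L P⟩)

/-- [folklore] the start site IS the charted centre `e (emb y)` of the V1 coarse site `y = e⁻¹ i.1`. -/
theorem stOf_eq_siteIdx_emb {j k : ℕ} (h : j + (k + 1) = P.K) (μ : Fin P.d) (i : idx P.L (unitMod P) k) :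
    stOf P k μ i = siteIdx P h (emb ((siteIdx P (j := j + 1) (k := k) (by omega)).symm i.1)) := by
  rw [siteIdx_emb, Equiv.apply_symm_apply]; rfl

/-- [folklore] `cpt` of a unit vector is `L` fine steps: `cpt (e_ν) = tstep ν L`. -/
theorem cpt_unitVec (k : ℕ) (ν : Fin P.d) :
    cpt (lev P.L k) P.L (unitMod P) (unitVec (fine (lev P.L k) (unitMod P)) ν) = tstep (fine (P.L * lev P.L k) (unitMod P)) ν P.L := by
  funext μ
  simp only [cpt, tstep, unitVec]
  by_cases hμ : μ = ν
  · subst hμ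
    have hne : fine (lev P.L k) (unitMod P) μ ≠ 1 := by
      have h1 := one_le_lev' P.L k
      have h2 : 2 ≤ unitMod P μ := by
        show 2 ≤ 2 * P.L ^ P.m
        have := Nat.one_le_pow P.m P.L P.L_pos
        omega
      intro h
      have h3 : lev P.L k * unitMod P μ = 1 := h
      have h4 : 2 ≤ lev P.L k * unitMod P μ := le_trans h2 (Nat.le_mul_of_pos_left _ h1)
      omega
    rw [Pi.single_eq_same, if_pos rfl, ZMod.val_one'' hne, mul_one]
  · rw [Pi.single_eq_of_ne hμ, if_neg hμ, ZMod.val_zero, mul_zero, Nat.cast_zero]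

/-- [folklore] **THE START-SITE SHIFT LAW** (`FactorisationData.start_shift` at the datum): neighbouring coarse indices have start sites `L` fine steps apart. -/
theorem stOf_tau (k : ℕ) (μ ν : Fin P.d) (i : idx P.L (unitMod P) k) :
    stOf P k μ (tau (fine (lev P.L k) (unitMod P)) ν i) = stOf P k μ i + tstep (fine (P.L * lev P.L k) (unitMod P)) ν P.L := by
  unfold stOf tau
  rw [cpt_add, cpt_unitVec]
  abel

end Geometry

/-! ## §2 Level reindexing of `towerOf` -/

section Reindex

variable {P} {G : Type*} [GaugeGroup G] {o : Type*} [Fintype o] [DecidableEq o] (ι : G →* Matrix o o ℂ)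

/-- [folklore] **`towerOf` AT ANY NAME OF ITS V1 LEVEL**: for every `n` with `n + k = K`, `towerOf P ι U k = transV (siteIdx P hn) ι (U n)` — the `K − k` of
p217365's definition replaced by a caller-chosen `n` (e.g. `j + 1`), so that `line`∕`corr` typecheck without casts. -/
theorem towerOf_eq_of_level (U : (j : ℕ) → GaugeField P j G) {k n : ℕ} (hn : n + k = P.K) :
    towerOf P ι U k = transV (siteIdx P (j := n) (k := k) hn) ι (U n) := by
  have hk : k ≤ P.K := by omega
  have e : P.K - k = n := by omega
  rw [towerOf_of_le ι U hk]
  subst e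
  rfl

/-- [folklore] … hence in the chart at level name `n`: `towerOf P ι U k ν (e x, μ) = ι (U n ⟨x, ν⟩)`. -/
theorem towerOf_chart' (U : (j : ℕ) → GaugeField P j G) {k n : ℕ} (hn : n + k = P.K) (ν μ : Fin P.d) (x : Site P n) :
    towerOf P ι U k ν (siteIdx P (j := n) (k := k) hn x, μ) = ι (U n ⟨x, ν⟩) := by
  rw [towerOf_eq_of_level ι U hn, transV_chart]

/-- [folklore] … and at a general index, through the inverse chart. -/
theorem towerOf_apply' (U : (j : ℕ) → GaugeField P j G) {k n : ℕ} (hn : n + k = P.K) (ν : Fin P.d) (i : idx P.L (unitMod P) k) :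
    towerOf P ι U k ν i = ι (U n ⟨(siteIdx P (j := n) (k := k) hn).symm i.1, ν⟩) := by
  obtain ⟨y, μ⟩ := i
  rw [towerOf_eq_of_level ι U hn]
  rfl

end Reindex

/-! ## §3 The factorisation clauses at the datum -/

section Clauses

variable {P} {G : Type*} [GaugeGroup G] {o : Type*} [Fintype o] [DecidableEq o] (ι : G →* Matrix o o ℂ) (ℰ : LoopAverage G)

/-- [folklore] **THE LINE OF A LEVEL ABOVE A COARSE INDEX, read through the towers**: for `n + (k+1) = K` and `U : (j : ℕ) → GaugeField P j G`,
`ι (pathProd (U n) c m) = Π_{t<m} towerOf P ι U (k+1) c.dir (e (lineSite c t), μ′)` (ordered `List` product; `c : PBond P (n+1)`). -/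
theorem iota_pathProd_eq_prod_towerOf (U : (j : ℕ) → GaugeField P j G) {k n : ℕ} (hn : n + (k + 1) = P.K) (c : PBond P (n + 1)) (μ' : Fin P.d)
    (m : ℕ) :
    ι (pathProd (U n) c m) = ((List.range m).map fun t =>
      towerOf P ι U (k + 1) c.dir (siteIdx P (j := n) (k := k + 1) hn (emb c.src) + tstep (fine (lev P.L (k + 1)) (unitMod P)) c.dir t, μ')).prod := by
  rw [SubstrateAvgTowerPlumbing.iota_pathProd_eq_list_prod]
  congr 1
  refine List.map_congr_left fun t _ => ?_
  rw [← siteIdx_lineSite, towerOf_chart']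
  rfl

/-- [folklore] **THE STRAIGHT CLAUSE** (`FactorisationData.straight` at the datum): below the finest level the axial tower is the ordered product of the next
level along the line starting at `stOf`: `S k μ i = Π_{t<L} S (k+1) μ (stOf k μ i + tstep μ t, i.2)`, `S := towerOf P ι (axialTower V)`. -/
theorem straight_clause (V : GaugeField P 0 G) {k : ℕ} (hk : k < P.K) (μ : Fin P.d) (i : idx P.L (unitMod P) k) :
    towerOf P ι (axialTower V) k μ i = ((List.range P.L).map fun t =>
      towerOf P ι (axialTower V) (k + 1) μ (stOf P k μ i + tstep (fine (P.L * lev P.L k) (unitMod P)) μ t, i.2)).prod := by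
  have hn : (P.K - (k + 1)) + (k + 1) = P.K := by omega
  have hn' : (P.K - (k + 1) + 1) + k = P.K := by omega
  rw [towerOf_apply' ι _ hn', axialTower_succ, iota_pathProd_eq_prod_towerOf ι _ hn, stOf_eq_siteIdx_emb P hn]
  rfl

/-- [folklore] **THE ONE-STEP CORRECTIONS AT THE DATUM** (`FactorisationData`'s `Cf`): below the finest level, `ι` of the correction factor `corr ℰ U_j c` of the
V1 bond `c = ⟨e⁻¹ i.1, μ⟩` at level `j + 1 = K − k`; `1` at and beyond the finest level. -/
def CfOf (V : GaugeField P 0 G) (k : ℕ) (μ : Fin P.d) (i : idx P.L (unitMod P) k) : Matrix o o ℂ :=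
  if h : k < P.K then
    ι (corr ℰ (avgTower ℰ V (P.K - (k + 1))) ⟨(siteIdx P (j := P.K - (k + 1) + 1) (k := k) (by omega)).symm i.1, μ⟩)
  else 1

/-- [folklore] `CfOf` below the finest level. -/
theorem CfOf_of_lt (V : GaugeField P 0 G) {k : ℕ} (h : k < P.K) (μ : Fin P.d) (i : idx P.L (unitMod P) k) :
    CfOf ι ℰ V k μ i = ι (corr ℰ (avgTower ℰ V (P.K - (k + 1))) ⟨(siteIdx P (j := P.K - (k + 1) + 1) (k := k) (by omega)).symm i.1, μ⟩) := by
  rw [CfOf, dif_pos h]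

/-- [folklore] `CfOf` at and beyond the finest level is `1`. -/
theorem CfOf_of_le (V : GaugeField P 0 G) {k : ℕ} (h : P.K ≤ k) (μ : Fin P.d) (i : idx P.L (unitMod P) k) : CfOf ι ℰ V k μ i = 1 := by
  rw [CfOf, dif_neg (not_lt.mpr h)]

/-- [folklore] **THE AVERAGING CLAUSE** (`FactorisationData.averaging` at the datum): `R k μ i = CfOf k μ i · Π_{t<L} R (k+1) μ (stOf k μ i + tstep μ t, i.2)`,
`R := towerOf P ι (avgTower ℰ V)`, `k < K` — PART 1's `avgTower_succ` read through the charts. -/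
theorem averaging_clause (V : GaugeField P 0 G) {k : ℕ} (hk : k < P.K) (μ : Fin P.d) (i : idx P.L (unitMod P) k) :
    towerOf P ι (avgTower ℰ V) k μ i = CfOf ι ℰ V k μ i * ((List.range P.L).map fun t =>
      towerOf P ι (avgTower ℰ V) (k + 1) μ (stOf P k μ i + tstep (fine (P.L * lev P.L k) (unitMod P)) μ t, i.2)).prod := by
  have hn : (P.K - (k + 1)) + (k + 1) = P.K := by omega
  have hn' : (P.K - (k + 1) + 1) + k = P.K := by omega
  rw [towerOf_apply' ι _ hn', avgTower_succ, map_mul, CfOf_of_lt ι ℰ V hk, iota_pathProd_eq_prod_towerOf ι _ hn, stOf_eq_siteIdx_emb P hn]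
  rfl

/-- [folklore] **THE CORRECTION LETTER AT THE DATUM** (`FactorisationData.corr`): through a `dist1`-realising representation (`‖ι g − 1‖ = dist1 g`), PART 1's
DISPLAYED one-step letter `hκ` (indexed by the coarse NE2 level, `i + 1 + k = K`) gives `‖CfOf k μ i − 1‖ ≤ κ∕(lev L k)²` below the finest level. -/
theorem corr_clause (hdist : ∀ g, ‖ι g - 1‖ = dist1 g) (V : GaugeField P 0 G) {κ : ℝ}
    (hκ : ∀ (i k : ℕ), i + 1 + k = P.K → ∀ c : PBond P (i + 1), dist1 (corr ℰ (avgTower ℰ V i) c) * ((lev P.L k : ℕ) : ℝ) ^ 2 ≤ κ)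
    {k : ℕ} (hk : k < P.K) (μ : Fin P.d) (i : idx P.L (unitMod P) k) : ‖CfOf ι ℰ V k μ i - 1‖ ≤ κ / ((lev P.L k : ℕ) : ℝ) ^ 2 := by
  have hℓ : (0 : ℝ) < ((lev P.L k : ℕ) : ℝ) ^ 2 := pow_pos (by exact_mod_cast one_le_lev' P.L k) 2
  rw [CfOf_of_lt ι ℰ V hk, hdist, le_div_iff₀ hℓ]
  exact hκ _ k (by omega) _

/-- [folklore] **AT AND BEYOND THE FINEST LEVEL THE TWO TOWERS AGREE** (`FactorisationData.fin_eq`): at `k = K` both read `ι V`, beyond both read `1`. -/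
theorem fin_eq_clause (V : GaugeField P 0 G) {k : ℕ} (hk : P.K ≤ k) :
    towerOf P ι (avgTower ℰ V) k = towerOf P ι (axialTower V) k := by
  rcases hk.eq_or_lt with h | h
  · subst h
    rw [towerOf_eq_of_level ι _ (n := 0) (by omega), towerOf_eq_of_level ι _ (n := 0) (by omega)]
    rfl
  · rw [towerOf_of_lt ι _ h, towerOf_of_lt ι _ h]

/-- [folklore] **FINEST SIZE** (`FactorisationData.fin_size` at the datum): the finest letter `L^K·dist1 (V b) ≤ α′` gives `‖L^k(S k − 1)‖ ≤ α′` at every `k ≥ K`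
(`k = K`: p217365 `size_towerOf_of_le` at the level name `0`; `k > K`: `S = 1`). -/
theorem fin_size_clause (hdist : ∀ g, ‖ι g - 1‖ = dist1 g) (V : GaugeField P 0 G) {α' : ℝ} (hα0 : 0 ≤ α')
    (hα' : ∀ b : PBond P 0, (P.L : ℝ) ^ P.K * dist1 (V b) ≤ α') {k : ℕ} (hk : P.K ≤ k) (μ : Fin P.d) (x : idx P.L (unitMod P) k) :
    ‖((lev P.L k : ℕ) : ℂ) • (towerOf P ι (axialTower V) k μ x - 1)‖ ≤ α' := by
  rcases hk.eq_or_lt with h | h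
  · subst h
    rw [towerOf_apply' ι _ (n := 0) (by omega), norm_smul, norm_lev, hdist]
    exact hα' _
  · rw [towerOf_of_lt ι _ h, sub_self, smul_zero, norm_zero]; exact hα0

/-- [folklore] **FINEST LIPSCHITZ** (`FactorisationData.fin_lip` at the datum): the finest letter `L^K·‖ι V(x + e_μ, ν) − ι V(x, ν)‖ ≤ β′∕L^K` gives the tower
Lipschitz clause `≤ β′∕lev L k` at every `k ≥ K`. -/
theorem fin_lip_clause (V : GaugeField P 0 G) {β' : ℝ} (hβ0 : 0 ≤ β')
    (hβ' : ∀ (x : Site P 0) (ν μ : Fin P.d), (P.L : ℝ) ^ P.K * ‖ι (V ⟨x.shift μ, ν⟩) - ι (V ⟨x, ν⟩)‖ ≤ β' / (P.L : ℝ) ^ P.K)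
    {k : ℕ} (hk : P.K ≤ k) (μ ν : Fin P.d) (x : idx P.L (unitMod P) k) :
    ‖((lev P.L k : ℕ) : ℂ) • (towerOf P ι (axialTower V) k μ (tau (fine (lev P.L k) (unitMod P)) ν x) - towerOf P ι (axialTower V) k μ x)‖
      ≤ β' / (lev P.L k : ℕ) := by
  rcases hk.eq_or_lt with h | h
  · subst h
    obtain ⟨y, μ'⟩ := x
    obtain ⟨z, rfl⟩ := (siteIdx P (j := 0) (k := P.K) (by omega)).surjective y
    have htau : tau (fine (lev P.L P.K) (unitMod P)) ν (siteIdx P (j := 0) (k := P.K) (by omega) z, μ')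
        = (siteIdx P (j := 0) (k := P.K) (by omega) (z.shift ν), μ') := by
      rw [siteIdx_shift]; rfl
    rw [htau, towerOf_chart' ι _ (by omega), towerOf_chart' ι _ (by omega), norm_smul, norm_lev, cast_lev']
    exact hβ' z μ ν
  · rw [towerOf_of_lt ι _ h, sub_self, smul_zero, norm_zero]; positivity

end Clauses

end Summit.QuantumFields.BalabanUV.T4Continuum.SubstrateAvgTowerFactorisation

end
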